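import Summits.CriticalPhenomena.SAWScalingLimit.Theorems.SAWDevelopingMapInteriorFlatteningLiouvilleBulkNoFold
import Summits.CriticalPhenomena.SAWScalingLimit.Theorems.SAWDevelopingMapInteriorFlatteningLiouvilleNecessity
import Literature.Probability.RandomPlanarGeometry.HexParafermionModeIdentities

/-!
# The crux `InteriorFlattening` in first-arrival form

Crux `stmt-CriticalPhenomena-8297` (`Summit.CriticalPhenomena.SAWScalingLimit.Theses.SAWDevelopingMap.InteriorFlattening`), line
`liouville-local-limits`, lead `prover-line-stmt-CriticalPhenomena-8297-c3-0` (cycle 3). By the Literature mode identities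
(`HexParafermionModeIdentities`, landed from this line: DCS's grouping in triplets read in the two non-trivial characters of
`ℤ/3`), at every vertex `v ∈ Λ` with a CLOCKWISE frame `(w₀, w₁, w₂)` and every boundary root `a`, the two modes of the
observable that the crux compares are FIXED real multiples of the same modes of the FIRST ARRIVALS `A_j`
(`firstArrivalObservable Λ a x_c (5/8) v w_j`: walks reaching `{v, w_j}` from `w_j` without having visited `v`), up to the loop
walks `L_j` (`loopArrivalObservable`: through `v` and back):

  `fieldBelt (obs Λ a) v w₀ w₁ w₂ = κ_B · (A₀ + ωA₁ + ω²A₂) + (L₀ + ωL₁ + ω²L₂)`,  `κ_B = 1 + 2x_c cos(11π/24) = 1.1413…`,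
  `fieldMono (obs Λ a) v w₀ w₁ w₂ = κ_M · (A₀ + A₁ + A₂) + (L₀ + L₁ + L₂)`,        `κ_M = 1 + 2x_c cos(5π/24) = 1.8587…`

(`obs_modes_eq_firstArrival`, the registered sub-goal). Consequently (`ratioAtDepth_iff_firstArrival`, with
`BulkNoFold.ratioAtDepth_iff_cw`) the crux matrix `RatioAtDepth R η` (`η ≥ 0`) reads: at every `R`-deep vertex of every simply
connected domain with a boundary root, in every clockwise frame,
`‖κ_B (A₀ + ωA₁ + ω²A₂) + (L₀ + ωL₁ + ω²L₂)‖ ≤ η ‖κ_M (A₀ + A₁ + A₂) + (L₀ + L₁ + L₂)‖` — a statement about ONE family of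
positive-weight walk classes per vertex (binning the first arrivals by total turning `J` gives positive masses `o_J` and
`A₀ + ωA₁ + ω²A₂ = c Σ_J o_J e^{+i82.5°J}`, `A₀ + A₁ + A₂ = c Σ_J o_J e^{-i37.5°J}`: the two-character form of the lead's analysis;
`κ_B/κ_M = 0.6140…` is the quotient of a single class, `HV.singleton_quotient_pos_lt_one`). Sources: H. Duminil-Copin,
S. Smirnov, Ann. of Math. 175 (2012) 1653–1665, proof of Lemma 1; the line card `Cruxes/InteriorFlattening/Lines/liouville-local-limits.md`.
-/

noncomputable section

open Literature.Probability.LatticeModels Literature.Probability.RandomPlanarGeometry.SAW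

namespace Summit.CriticalPhenomena.SAWScalingLimit.Theorems.InteriorFlattening.Liouville

/-- **The observable's two modes at a vertex in first-arrival form** (registered sub-goal). For a boundary root `a`,
`v ∈ Λ` and a clockwise frame (`c w₁ - c v = ζ⁴ (c w₀ - c v)`, `c w₂ - c v = ζ² (c w₀ - c v)`):
`B(F) = κ_B B(A) + B(L)` and `M(F) = κ_M M(A) + M(L)` with `κ_B = 1 + 2x_c cos(11π/24)`, `κ_M = 1 + 2x_c cos(5π/24)`. -/
theorem obs_modes_eq_firstArrival :
    ∀ (Λ : Finset HexVertex) (a : Sym2 HexVertex) (v w₀ w₁ w₂ : HexVertex), a ∈ hexDomainBoundary Λ → v ∈ Λ →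
      hexGraph.Adj v w₀ → hexGraph.Adj v w₁ → hexGraph.Adj v w₂ → w₀ ≠ w₁ → w₁ ≠ w₂ → w₀ ≠ w₂ →
      hexCenter w₁ - hexCenter v = triZeta ^ 4 * (hexCenter w₀ - hexCenter v) →
      hexCenter w₂ - hexCenter v = triZeta ^ 2 * (hexCenter w₀ - hexCenter v) →
        fieldBelt (obs Λ a) v w₀ w₁ w₂ =
            ((1 + 2 * hexCriticalFugacity * Real.cos (11 * Real.pi / 24) : ℝ) : ℂ) *
                (firstArrivalObservable Λ a xc (5 / 8) v w₀ + omega * firstArrivalObservable Λ a xc (5 / 8) v w₁ +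
                  omega ^ 2 * firstArrivalObservable Λ a xc (5 / 8) v w₂) +
              (loopArrivalObservable Λ a xc (5 / 8) v w₀ + omega * loopArrivalObservable Λ a xc (5 / 8) v w₁ +
                omega ^ 2 * loopArrivalObservable Λ a xc (5 / 8) v w₂) ∧
          fieldMono (obs Λ a) v w₀ w₁ w₂ =
            ((1 + 2 * hexCriticalFugacity * Real.cos (5 * Real.pi / 24) : ℝ) : ℂ) *
                (firstArrivalObservable Λ a xc (5 / 8) v w₀ + firstArrivalObservable Λ a xc (5 / 8) v w₁ +
                  firstArrivalObservable Λ a xc (5 / 8) v w₂) +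
              (loopArrivalObservable Λ a xc (5 / 8) v w₀ + loopArrivalObservable Λ a xc (5 / 8) v w₁ +
                loopArrivalObservable Λ a xc (5 / 8) v w₂) := by
  intro Λ a v w₀ w₁ w₂ ha hv h₀ h₁ h₂ h01 h12 h02 hd₁ hd₂
  have hω : omega = triZeta ^ 2 := Necessity.omega_eq_triZeta_sq
  have hω2 : omega ^ 2 = triZeta ^ 4 := by rw [hω, ← pow_mul]
  refine ⟨?_, ?_⟩
  · simp only [fieldBelt, obs]
    rw [hω2, hω]
    exact observable_cw_beltrami_eq ha hv h₀ h₁ h₂ h01 h12 h02 hd₁ hd₂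
  · simp only [fieldMono, obs]
    exact observable_sum_eq_real ha hv h₀ h₁ h₂ h01 h12 h02

/-- **The crux matrix in first-arrival form.** For `η ≥ 0`, `RatioAtDepth R η` holds iff at every `R`-deep vertex of every
simply connected domain with a boundary root, in every clockwise frame,
`‖κ_B (A₀ + ωA₁ + ω²A₂) + (L₀ + ωL₁ + ω²L₂)‖ ≤ η ‖κ_M (A₀ + A₁ + A₂) + (L₀ + L₁ + L₂)‖`
(counter-clockwise frames are free by Lemma 1, `BulkNoFold.ratioAtDepth_iff_cw`). -/
theorem ratioAtDepth_iff_firstArrival {R η : ℝ} (hη : 0 ≤ η) :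
    RatioAtDepth R η ↔
      ∀ (Λ : Finset HexVertex), hexDomainSimplyConnected Λ → ∀ a ∈ hexDomainBoundary Λ, ∀ v ∈ Λ,
        Deep Λ v R → ∀ w₀ w₁ w₂ : HexVertex,
          hexGraph.Adj v w₀ → hexGraph.Adj v w₁ → hexGraph.Adj v w₂ →
          hexCenter w₁ - hexCenter v = triZeta ^ 4 * (hexCenter w₀ - hexCenter v) →
          hexCenter w₂ - hexCenter v = triZeta ^ 2 * (hexCenter w₀ - hexCenter v) →
            ‖((1 + 2 * hexCriticalFugacity * Real.cos (11 * Real.pi / 24) : ℝ) : ℂ) *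
                  (firstArrivalObservable Λ a xc (5 / 8) v w₀ + omega * firstArrivalObservable Λ a xc (5 / 8) v w₁ +
                    omega ^ 2 * firstArrivalObservable Λ a xc (5 / 8) v w₂) +
                (loopArrivalObservable Λ a xc (5 / 8) v w₀ + omega * loopArrivalObservable Λ a xc (5 / 8) v w₁ +
                  omega ^ 2 * loopArrivalObservable Λ a xc (5 / 8) v w₂)‖ ≤
              η * ‖((1 + 2 * hexCriticalFugacity * Real.cos (5 * Real.pi / 24) : ℝ) : ℂ) *
                  (firstArrivalObservable Λ a xc (5 / 8) v w₀ + firstArrivalObservable Λ a xc (5 / 8) v w₁ +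
                    firstArrivalObservable Λ a xc (5 / 8) v w₂) +
                (loopArrivalObservable Λ a xc (5 / 8) v w₀ + loopArrivalObservable Λ a xc (5 / 8) v w₁ +
                  loopArrivalObservable Λ a xc (5 / 8) v w₂)‖ := by
  rw [BulkNoFold.ratioAtDepth_iff_cw hη]
  obtain ⟨h14, h42, h12⟩ := BulkNoFold.rot_factors_ne
  constructor
  · intro H Λ hΛ a ha v hv hdeep w₀ w₁ w₂ h₀ h₁ h₂ hd₁ hd₂
    have h01 : w₀ ≠ w₁ := BulkNoFold.ne_of_directions h14 h₀ (by rw [one_mul]) hd₁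
    have h12' : w₁ ≠ w₂ := BulkNoFold.ne_of_directions h42 h₀ hd₁ hd₂
    have h02 : w₀ ≠ w₂ := BulkNoFold.ne_of_directions h12 h₀ (by rw [one_mul]) hd₂
    obtain ⟨hB, hM⟩ := obs_modes_eq_firstArrival Λ a v w₀ w₁ w₂ ha hv h₀ h₁ h₂ h01 h12' h02 hd₁ hd₂
    rw [← hB, ← hM]
    exact H Λ hΛ a ha v hv hdeep w₀ w₁ w₂ h₀ h₁ h₂ hd₁ hd₂
  · intro H Λ hΛ a ha v hv hdeep w₀ w₁ w₂ h₀ h₁ h₂ hd₁ hd₂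
    have h01 : w₀ ≠ w₁ := BulkNoFold.ne_of_directions h14 h₀ (by rw [one_mul]) hd₁
    have h12' : w₁ ≠ w₂ := BulkNoFold.ne_of_directions h42 h₀ hd₁ hd₂
    have h02 : w₀ ≠ w₂ := BulkNoFold.ne_of_directions h12 h₀ (by rw [one_mul]) hd₂
    obtain ⟨hB, hM⟩ := obs_modes_eq_firstArrival Λ a v w₀ w₁ w₂ ha hv h₀ h₁ h₂ h01 h12' h02 hd₁ hd₂
    rw [hB, hM]
    exact H Λ hΛ a ha v hv hdeep w₀ w₁ w₂ h₀ h₁ h₂ hd₁ hd₂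

end Summit.CriticalPhenomena.SAWScalingLimit.Theorems.InteriorFlattening.Liouville

end
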